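import Literature.AnabelianGeometry.SemiGraphs.PSCSeparatingCoveringsSmoothCurve
import HarnessLib

/-!
# [CombGC] Prop. 1.2, proof p. 9, separating coverings (row F-2830): the inhabited smooth-curve origin, tripod witness

Mochizuki, *A combinatorial version of the Grothendieck conjecture* [CombGC], PROOF of Prop. 1.2, p. 9:
"there exists a finite étale … `Π_G`-covering `G' → G` whose restriction to the anabelioid `G_{e₂}` is
trivial …, but whose restriction to the anabelioid `G_{e₁}` is nontrivial"
[cite: MochizukiCombGC2007, Prop 1.2 proof p.9].  PROOF-ONLY companion of
`PSCSeparatingCoveringsSmoothCurve.lean` (abc-iut FACT-LIST rows F-2827 / F-2829 / F-2830 at genuine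
smooth-curve data): the smooth-curve origin `Ω_sc` of `PSCSmoothCurveShape.exists_smoothCurveOrigin_holds`
— data with one vertex `Π_v = Π`, no nodes, cusp groups the closed cusp inertia groups of a profinite
pro-`Σ` completion of a hyperbolic `Γ_{g,r}` — satisfies `SeparatingCoveringsHolds Ω_sc` (F-2830) JOINTLY
with F-0438, F-0459, F-0440, F-0461, F-0443, and is inhabited by the tripod `P¹ ∖ {0,1,∞}` (`Π = F̂₂`,
three cusps), at which the separating covering is exhibited for the cusps `0 ≠ 1` at EVERY open normal
level: the pair quantifier of the typed row is not vacuous here.  0 definitions; instance form at genuine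
data, not the multi-component statement; nothing here takes a side on [IUTchIII] Cor. 3.12.
-/

noncomputable section

namespace Literature.AnabelianGeometry.SemiGraphs

namespace PSCDatum

open scoped Pointwise
open Literature.GroupTheory.CombinatorialGroupTheory
open Literature.GroupTheory.CombinatorialGroupTheory.PuncturedSurfaceGroup (cuspInertia IsHyperbolicType)
open SemiGraphOfAnabelioids (IsProSigmaCompletion)
open Literature.IUT.HodgeTheaters (profiniteCompletion toCompletion)

/-! ### Inhabitation: the tripod, with an explicitly separated pair of cusps -/

/-- **The smooth-curve origin satisfies F-2830 (with a NON-vacuous edge conjunct) jointly with F-0438,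
F-0459, F-0440, F-0461, F-0443, and is inhabited by the tripod.**  `Ω_sc` := data of smooth-curve shape
over profinite pro-`Σ` completions of hyperbolic punctured surface groups (as in
`PSCSmoothCurveShape.exists_smoothCurveOrigin_holds`).  It contains the datum of `P¹ ∖ {0,1,∞}` in
characteristic `0` (`Π = Γ̂_{0,3} = F̂₂`, Mathlib's profinite completion, `Σ` = all primes, three cusps
`Π_{c_i} = closure η⟨c_i⟩`), AT WHICH, for the cusps `0 ≠ 1`, every open normal `V ⊴ Π` has an open `U`,
normal in `V`, containing `Π_{c₁} ∩ V` and not containing `Π_{c₀} ∩ V` — the separating covering of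
print, produced by the kernel.  Instance form at genuine data; not the multi-component statement.
[cite: MochizukiCombGC2007, Prop 1.2 proof p.9] -/
theorem exists_smoothCurveOrigin_separatingCoveringsHolds :
    ∃ Ω : PSCOrigin.{0},
      (∃ G : PSCDatum (profiniteCompletion (PuncturedSurfaceGroup 0 3)),
        Ω.IsOfPSCType G ∧ G.Sigma = {p : ℕ | p.Prime} ∧ G.graph.i = 1 ∧ G.graph.n = 0 ∧ G.graph.r = 3 ∧
          (∀ v, G.vertGp v = ⊤ ∧ G.genus v = 0) ∧ G.SeparatingCoverings ∧
          ∃ c₀ c₁ : G.graph.C, c₀ ≠ c₁ ∧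
            ∀ V : Subgroup (profiniteCompletion (PuncturedSurfaceGroup 0 3)),
              V.Normal → IsOpen (V : Set (profiniteCompletion (PuncturedSurfaceGroup 0 3))) →
              ∃ U : Subgroup (profiniteCompletion (PuncturedSurfaceGroup 0 3)),
                IsOpen (U : Set (profiniteCompletion (PuncturedSurfaceGroup 0 3))) ∧ U ≤ V ∧
                (U.subgroupOf V).Normal ∧ G.cuspGp c₁ ⊓ V ≤ U ∧ ¬ (G.cuspGp c₀ ⊓ V ≤ U)) ∧
      SeparatingCoveringsHolds Ω ∧ CommensurableTerminalityHolds Ω ∧ OpenInterDeterminesComponentHolds Ω ∧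
      EdgeLikeIncidenceHolds Ω ∧ UnrVerticialIffHolds Ω ∧ GraphicIffEdgeLikeVerticialHolds Ω := by
  let Ω : PSCOrigin.{0} :=
    ⟨fun {Q} _ _ G => ∃ (_ : IsTopologicalGroup Q), CompactSpace Q ∧ T2Space Q ∧
      TotallyDisconnectedSpace Q ∧ IsEmpty G.graph.N ∧ (∀ v, G.vertGp v = ⊤) ∧
      (∃ v₀ : G.graph.V, ∀ w, w = v₀) ∧
      ∃ (S : Set ℕ) (g r : ℕ) (ι : PuncturedSurfaceGroup g r →* Q) (e : G.graph.C ≃ Fin r),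
        S.Nonempty ∧ (∀ p ∈ S, p.Prime) ∧ IsHyperbolicType g r ∧
        IsProSigmaCompletion S ι ∧
        ∀ c, G.cuspGp c = ((cuspInertia (g := g) (e c)).map ι).topologicalClosure⟩
  have hΩ₁ : ∀ ⦃Q : Type⦄ [Group Q] [TopologicalSpace Q] [IsTopologicalGroup Q] (G : PSCDatum Q),
      Ω.IsOfPSCType G → CompactSpace Q ∧ T2Space Q ∧ TotallyDisconnectedSpace Q ∧ IsEmpty G.graph.N ∧
        (∀ v, G.vertGp v = ⊤) ∧ (∃ v₀ : G.graph.V, ∀ w, w = v₀) ∧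
        ∃ (S : Set ℕ) (g r : ℕ) (ι : PuncturedSurfaceGroup g r →* Q) (e : G.graph.C ≃ Fin r),
          S.Nonempty ∧ (∀ p ∈ S, p.Prime) ∧ IsHyperbolicType g r ∧ IsProSigmaCompletion S ι ∧
          ∀ c, G.cuspGp c = ((cuspInertia (g := g) (e c)).map ι).topologicalClosure :=
    fun Q _ _ _ G hG => by
      obtain ⟨_, hG'⟩ := hG
      exact hG'
  have hΩ₂ : ∀ ⦃Q : Type⦄ [Group Q] [TopologicalSpace Q] (G : PSCDatum Q), Ω.IsOfPSCType G →
      IsEmpty G.graph.N ∧ (∀ v, G.vertGp v = ⊤) ∧ Nonempty G.graph.V := fun Q _ _ G hG => by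
    obtain ⟨_, -, -, -, h4, h5, ⟨v₀, -⟩, -⟩ := hG
    exact ⟨h4, h5, ⟨v₀⟩⟩
  -- the tripod datum
  let Γ := PuncturedSurfaceGroup 0 3
  let η := toCompletion Γ
  have hη : IsProSigmaCompletion {p : ℕ | p.Prime} η :=
    SemiGraphOfAnabelioids.IsProSigmaCompletion.isProSigmaCompletion_toCompletion Γ
  have h03 : IsHyperbolicType 0 3 := by unfold IsHyperbolicType; norm_num
  have hpr : ∀ p ∈ {p : ℕ | p.Prime}, p.Prime := fun _ hp => hp
  have hne' : ({p : ℕ | p.Prime}).Nonempty := ⟨2, Nat.prime_two⟩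
  let T : PSCDatum (profiniteCompletion Γ) :=
    { Sigma := {p | p.Prime}
      sigma_prime := fun _ hp => hp
      sigma_nonempty := ⟨2, Nat.prime_two⟩
      graph := { V := Unit, N := Empty, C := Fin 3, nodeEnds := Empty.elim, cuspEnd := fun _ => () }
      vertGp := fun _ => ⊤
      nodeGp := Empty.elim
      cuspGp := fun i => ((cuspInertia (g := 0) i).map η).topologicalClosure
      genus := fun _ => 0
      isClosed_vertGp := fun _ => by rw [Subgroup.coe_top]; exact isClosed_univ
      isClosed_nodeGp := fun e => e.elim
      isClosed_cuspGp := fun _ => Subgroup.isClosed_topologicalClosure _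
      nodeGp_le := fun e => e.elim
      cuspGp_le := fun _ => ⟨1, le_top⟩
      proSigma := ⟨fun _ _ _ hp _ => hp⟩ }
  haveI : IsEmpty T.graph.N := inferInstanceAs (IsEmpty Empty)
  have hTC : ∀ c, T.cuspGp c = ((cuspInertia (g := 0) ((Equiv.refl (Fin 3)) c)).map η).topologicalClosure :=
    fun _ => rfl
  have hT : Ω.IsOfPSCType T :=
    ⟨inferInstance, inferInstance, inferInstance, inferInstance, inferInstanceAs (IsEmpty Empty),
      fun _ => rfl, ⟨(), fun _ => rfl⟩, {p | p.Prime}, 0, 3, η, Equiv.refl _, hne', hpr, h03, hη, hTC⟩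
  have h01 : ((0 : Fin 3) : T.graph.C) ≠ (1 : Fin 3) := by decide
  refine ⟨Ω, ⟨T, hT, rfl, rfl, rfl, rfl, fun _ => ⟨rfl, rfl⟩,
    T.separatingCoverings_of_smoothCurve hne' hpr h03 η hη (Equiv.refl _) hTC (fun _ => rfl) () (fun _ => rfl),
    (0 : Fin 3), (1 : Fin 3), h01, fun V hVn hVo => ?_⟩, ?_, ?_, ?_, ?_, ?_, ?_⟩
  · haveI := hVn
    exact T.exists_open_separating_cusps_of_smoothCurve hne' hpr h03 η hη (Equiv.refl _) hTC h01 V hVo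
  · exact separatingCoveringsHolds_of_smoothCurve Ω hΩ₁
  · exact commensurableTerminalityHolds_of_smoothCurve Ω hΩ₁
  · exact openInterDeterminesComponentHolds_of_smoothCurve Ω fun Q _ _ _ G hG => by
      obtain ⟨h1, h2, h3, h4, -, h6, h7⟩ := hΩ₁ G hG
      exact ⟨h1, h2, h3, h4, h6, h7⟩
  · exact edgeLikeIncidenceHolds_of_vertGp_eq_top Ω hΩ₂
  · exact unrVerticialIffHolds_of_vertGp_eq_top Ω fun Q _ _ G hG => ⟨(hΩ₂ G hG).2.1, (hΩ₂ G hG).2.2⟩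
  · exact graphicIffEdgeLikeVerticialHolds_of_smoothCurve Ω hΩ₁ hΩ₂

end PSCDatum

end Literature.AnabelianGeometry.SemiGraphs

end
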